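import Summits.AtomisticToContinuum.BoseEinsteinCondensation.Theorems.BECRewardDescentRewardChordBoundChordFromModulus

/-!
# Crux `RewardChordBound` (stmt-AtomisticToContinuum-12876), line `dyadic-secant` — stub `stub_secantWalk`,
# part 1/2: the secant walk for a concave non-decreasing REAL curve (helper file; the stub itself is part 2/2,
# `BECRewardDescentRewardChordBoundSecantWalk.lean`)

Registered stub `Summit.AtomisticToContinuum.BoseEinsteinCondensation.Cruxes.RewardChordBound.DyadicSecant.stub_secantWalk`
of the crux skeleton `Cruxes/RewardChordBound/Lines/birth.lean` (lead c2 reshape: the strategist's alternative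
composition `RewardChordBound ⇐ stub_shellModulus ∧ stub_secantWalk` carried beside the `Birth` composition).

Statement (abstract, over a family `i ↦ Eᵢ + t·Dᵢ` in `ℝ≥0∞` with `Dᵢ ≤ N`, `⨅ Eᵢ < ∞`, reward curve
`R(t) = ⨅ᵢ (Eᵢ + t·Dᵢ)` and a predicate `P` implied by `Dᵢ < ηN`): for `η, K, τ > 0`, `σ ∈ (0, 1]` there is
`θ ∈ (0, σ/4]` such that IF (rung) `R(s₀) ≤ ⨅E + s₀(η/4)N` at `s₀ = θρa` and (shells) for every `u` with
`4u ≤ σρa`, whenever the near-minimisers of `Eᵢ + w·Dᵢ` satisfy `P` for each `w ∈ (2u, 4u]` one has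
`3R(2u) ≤ 2R(u) + R(4u) + KNu√(u/(ρa))`, THEN `R(s) + (s/s₀)⨅E ≤ ⨅E + (s/s₀)R(s₀) + sτN` on `(0, s₀]`.

## Proof (no derivatives, no continuity — secants of the concave, non-decreasing real curve `f = R.toReal`)

* Griffiths' lemma in secant form (`WalkGlue.le_slope_add_of_near_min`): if some secant slope `σ(w', w) < ηN`
  (`0 ≤ w' < w`), then for a suitable `δ > 0` every `δ`-near-minimiser `i` at reward `w` has `Dᵢ < ηN`, hence `P i`.
  Call such `w` GOOD. Good rewards are upward closed (secant slopes of a concave function decrease), and every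
  `w ≥ s₀` is good by the rung (`σ(0, w) ≤ σ(0, s₀) ≤ ηN/4`).
* One shell in secant form: `σ(u, 2u) ≤ σ(2u, 4u) + A√u` with `A = KN/(2√(ρa))`; the POTENTIAL
  `g(u) = σ(u,2u) + (5/2)A√u` is then non-decreasing under doubling (`7/5 ≤ √2`), so along any dyadic chain of
  available shells `σ(u, 2u) ≤ g(top) ≤ σ(0, s₀) + (5/2)A√s₀` — no geometric series is summed.
* Frontier: `s* = inf {good}`; if `s* > 0`, all shells with `2u ≥ s*` are available (their upper half-shells are
  good), the ascending chain from `u = s*/2` gives `σ(s*/2, s*) ≤ ηN/4 + (5/2)A√s₀ ≤ ηN/2`, and monotonicity of `f`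
  alone gives `σ(s*/2, 7s*/8) ≤ (4/3)σ(s*/2, s*) < ηN`, so `7s*/8` is good — contradiction. Hence every `w > 0`
  is good and every shell `4u ≤ σρa` is available.
* Descending chain anchored at `s₀`: `σ(s₀2^{-m-1}, s₀2^{-m}) ≤ B := σ(0,s₀) + (5/2)A√s₀`; telescoping with
  `f(t) − f(0) ≤ tN` gives `σ(0, s₀2^{-m}) ≤ B`, and `σ(0, s) ≤ σ(0, s₀2^{-m}) ≤ B` for `s₀2^{-m} ≤ s`.
* Constants: `(5/2)A√s₀ = (5/4)K√θ·N`; `θ := min(σ/4, (min(τ/2, η/5)/K)²)`.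

References: concavity of a ground-state energy in a coupling constant and the near-minimiser slope bound
[Griffiths1966, §III]; [Kato1966, VII §3]; route text of BECRewardDescent (items WalkGlue / RewardChordBound);
strategist line card `Cruxes/RewardChordBound/Lines/dyadic-secant.md`.
-/

noncomputable section

open Set Filter Topology
open scoped ENNReal

namespace Summit.AtomisticToContinuum.BoseEinsteinCondensation.Cruxes.RewardChordBound.DyadicSecant

open Summit.AtomisticToContinuum.BoseEinsteinCondensation.Theorems.WalkGlue
open Summit.AtomisticToContinuum.BoseEinsteinCondensation.Cruxes.RewardChordBound.Birth.ChordFromModulus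

namespace SecantWalk

/-! ### Secant slopes of a concave function on `[0, ∞)` -/

/-- Secant slopes from a fixed left end point decrease as the right end point increases. [folklore] -/
theorem slope_right_anti {f : ℝ → ℝ} (hf : ConcaveOn ℝ (Ici 0) f) {x y z : ℝ} (hx : 0 ≤ x)
    (hxy : x < y) (hyz : y ≤ z) : slope f x z ≤ slope f x y := by
  rcases eq_or_lt_of_le hyz with rfl | hyz
  · exact le_rfl
  have h := hf.neg.secant_mono_aux2 (mem_Ici.2 hx) (mem_Ici.2 (by linarith)) hxy hyz
  simp only [Pi.neg_apply] at h
  rw [slope_def_field, slope_def_field]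
  have h1 : (-f y - -f x) / (y - x) = -((f y - f x) / (y - x)) := by ring
  have h2 : (-f z - -f x) / (z - x) = -((f z - f x) / (z - x)) := by ring
  rw [h1, h2] at h
  linarith

/-- Secant slopes to a fixed right end point decrease as the left end point increases. [folklore] -/
theorem slope_left_anti {f : ℝ → ℝ} (hf : ConcaveOn ℝ (Ici 0) f) {x y z : ℝ} (hx : 0 ≤ x)
    (hxy : x < y) (hyz : y < z) : slope f y z ≤ slope f x z := by
  have h := hf.neg.secant_mono_aux3 (mem_Ici.2 hx) (mem_Ici.2 (by linarith)) hxy hyz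
  simp only [Pi.neg_apply] at h
  rw [slope_def_field, slope_def_field]
  have h1 : (-f z - -f x) / (z - x) = -((f z - f x) / (z - x)) := by ring
  have h2 : (-f z - -f y) / (z - y) = -((f z - f y) / (z - y)) := by ring
  rw [h1, h2] at h
  linarith

/-- Secant slopes of a non-decreasing function are non-negative. [folklore] -/
theorem slope_nonneg_of_monotoneOn {f : ℝ → ℝ} (hf : MonotoneOn f (Ici 0)) {x y : ℝ} (hx : 0 ≤ x)
    (hxy : x < y) : 0 ≤ slope f x y := by
  rw [slope_def_field]
  exact div_nonneg (sub_nonneg.2 (hf (mem_Ici.2 hx) (mem_Ici.2 (by linarith)) hxy.le))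
    (by linarith)

/-! ### The shell potential `g(u) = σ(u, 2u) + (5/2)·A·√u` -/

/-- `7/5 ≤ √2`. [folklore] -/
theorem seven_fifths_le_sqrt_two : (7 : ℝ) / 5 ≤ Real.sqrt 2 := by
  rw [show (7 : ℝ) / 5 = Real.sqrt ((7 / 5) ^ 2) by rw [Real.sqrt_sq (by norm_num)]]
  exact Real.sqrt_le_sqrt (by norm_num)

/-- **One RG step for the potential.** If the shell `(u, 4u]` is available,
`σ(u,2u) ≤ σ(2u,4u) + A√u`, then `g(u) ≤ g(2u)` for `g(u) = σ(u,2u) + (5/2)A√u`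
(because `1 + 5/2 ≤ (5/2)√2`). [folklore] -/
theorem potential_step {f : ℝ → ℝ} {A u : ℝ} (hA : 0 ≤ A)
    (h : slope f u (2 * u) ≤ slope f (2 * u) (4 * u) + A * Real.sqrt u) :
    slope f u (2 * u) + 5 / 2 * A * Real.sqrt u ≤
      slope f (2 * u) (2 * (2 * u)) + 5 / 2 * A * Real.sqrt (2 * u) := by
  have h4 : (2 : ℝ) * (2 * u) = 4 * u := by ring
  rw [h4, Real.sqrt_mul (by norm_num : (0 : ℝ) ≤ 2) u]
  have hAu : 0 ≤ A * Real.sqrt u := mul_nonneg hA (Real.sqrt_nonneg u)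
  have hkey := mul_le_mul_of_nonneg_left seven_fifths_le_sqrt_two hAu
  nlinarith [hkey]

/-- **Ascending chain.** If every shell with `u₀ ≤ u ≤ s₀/2` is available, then for every `u ≥ u₀` with
`2^k u ≤ s₀ < 2^(k+1) u` the potential at `u` is at most `σ(0, s₀) + (5/2)A√s₀`. [folklore] -/
theorem ascending_chain {f : ℝ → ℝ} (hf : ConcaveOn ℝ (Ici 0) f) {A s₀ u₀ : ℝ} (hA : 0 ≤ A)
    (hs₀ : 0 < s₀) (hu₀ : 0 < u₀)
    (havail : ∀ u, u₀ ≤ u → u ≤ s₀ / 2 → slope f u (2 * u) ≤ slope f (2 * u) (4 * u) + A * Real.sqrt u) :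
    ∀ (k : ℕ) (u : ℝ), u₀ ≤ u → 2 ^ k * u ≤ s₀ → s₀ < 2 ^ (k + 1) * u →
      slope f u (2 * u) + 5 / 2 * A * Real.sqrt u ≤ slope f 0 s₀ + 5 / 2 * A * Real.sqrt s₀ := by
  intro k
  induction k with
  | zero =>
    intro u hu hk hk'
    simp only [pow_zero, one_mul, zero_add, pow_one] at hk hk'
    have hu0 : 0 < u := hu₀.trans_le hu
    have h1 : slope f u (2 * u) ≤ slope f 0 (2 * u) := slope_left_anti hf le_rfl hu0 (by linarith)
    have h2 : slope f 0 (2 * u) ≤ slope f 0 s₀ := slope_right_anti hf le_rfl hs₀ hk'.le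
    have h3 : Real.sqrt u ≤ Real.sqrt s₀ := Real.sqrt_le_sqrt hk
    nlinarith [mul_le_mul_of_nonneg_left h3 hA]
  | succ k ih =>
    intro u hu hk hk'
    have hu0 : 0 < u := hu₀.trans_le hu
    have hpk : (1 : ℝ) ≤ 2 ^ k := one_le_pow₀ (by norm_num)
    have e1 : (2 : ℝ) ^ (k + 1) * u = 2 ^ k * (2 * u) := by rw [pow_succ]; ring
    have e2 : (2 : ℝ) ^ (k + 1 + 1) * u = 2 ^ (k + 1) * (2 * u) := by rw [pow_succ]; ring
    have hk2 : 2 ^ k * (2 * u) ≤ s₀ := by rw [← e1]; exact hk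
    have hk2' : s₀ < 2 ^ (k + 1) * (2 * u) := by rw [← e2]; exact hk'
    have h2u : 2 * u ≤ 2 ^ k * (2 * u) := le_mul_of_one_le_left (by positivity) hpk
    have hus : u ≤ s₀ / 2 := by
      rw [le_div_iff₀ (by norm_num : (0 : ℝ) < 2)]
      linarith
    have hstep := potential_step hA (havail u hu hus)
    exact hstep.trans (ih (2 * u) (by linarith) hk2 hk2')

/-- **Descending chain.** If every shell with `0 < u ≤ s₀/4` is available, then along the dyadic points
`s₀2^{-m}` the potential never exceeds its value at `s₀/2`, whence
`σ(s₀2^{-(m+1)}, s₀2^{-m}) ≤ σ(0, s₀) + (5/2)A√s₀`. [folklore] -/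
theorem descending_chain {f : ℝ → ℝ} (hf : ConcaveOn ℝ (Ici 0) f) {A s₀ : ℝ} (hA : 0 ≤ A) (hs₀ : 0 < s₀)
    (havail : ∀ u, 0 < u → u ≤ s₀ / 4 → slope f u (2 * u) ≤ slope f (2 * u) (4 * u) + A * Real.sqrt u) :
    ∀ m : ℕ, slope f (s₀ / 2 ^ (m + 1)) (s₀ / 2 ^ m) ≤ slope f 0 s₀ + 5 / 2 * A * Real.sqrt s₀ := by
  -- the potential along the dyadic points is bounded by its value at `s₀ / 2`
  have hpot : ∀ m : ℕ, slope f (s₀ / 2 ^ (m + 1)) (2 * (s₀ / 2 ^ (m + 1))) +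
      5 / 2 * A * Real.sqrt (s₀ / 2 ^ (m + 1)) ≤
      slope f (s₀ / 2) (2 * (s₀ / 2)) + 5 / 2 * A * Real.sqrt (s₀ / 2) := by
    intro m
    induction m with
    | zero => simp
    | succ m ih =>
      have hu : 0 < s₀ / 2 ^ (m + 2) := by positivity
      have hp4 : (4 : ℝ) ≤ 2 ^ (m + 2) := by
        calc (4 : ℝ) = 2 ^ 2 := by norm_num
          _ ≤ 2 ^ (m + 2) := pow_le_pow_right₀ (by norm_num) (by omega)
      have hus : s₀ / 2 ^ (m + 2) ≤ s₀ / 4 :=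
        div_le_div_of_nonneg_left hs₀.le (by norm_num) hp4
      have hstep := potential_step hA (havail _ hu hus)
      have h2u : 2 * (s₀ / 2 ^ (m + 2)) = s₀ / 2 ^ (m + 1) := by
        rw [pow_succ]
        field_simp
      rw [← h2u] at ih
      exact hstep.trans ih
  intro m
  have h2u : 2 * (s₀ / 2 ^ (m + 1)) = s₀ / 2 ^ m := by
    rw [pow_succ]
    field_simp
  have h1 := hpot m
  rw [h2u, show 2 * (s₀ / 2) = s₀ by ring] at h1
  have h2 : slope f (s₀ / 2) s₀ ≤ slope f 0 s₀ := slope_left_anti hf le_rfl (by positivity) (by linarith)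
  have h3 : Real.sqrt (s₀ / 2) ≤ Real.sqrt s₀ := Real.sqrt_le_sqrt (by linarith)
  have h4 : 0 ≤ Real.sqrt (s₀ / 2 ^ (m + 1)) := Real.sqrt_nonneg _
  nlinarith [mul_le_mul_of_nonneg_left h3 hA, mul_nonneg hA h4]

/-- **From dyadic secants to chords from `0`.** If `f(t) − f(0) ≤ tN` and every dyadic secant
`σ(s₀2^{-(m+1)}, s₀2^{-m})` is at most `B ≥ 0`, then `σ(0, s₀2^{-m}) ≤ B` for every `m`
(telescoping; the remainder `f(s₀2^{-M}) − f(0) ≤ s₀2^{-M}N` tends to zero). [folklore] -/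
theorem slope_zero_dyadic_le {f : ℝ → ℝ} {s₀ B N : ℝ} (hs₀ : 0 < s₀) (hB : 0 ≤ B) (hN : 0 ≤ N)
    (hlip : ∀ t, 0 ≤ t → f t ≤ f 0 + t * N)
    (hdy : ∀ m : ℕ, slope f (s₀ / 2 ^ (m + 1)) (s₀ / 2 ^ m) ≤ B) :
    ∀ m : ℕ, slope f 0 (s₀ / 2 ^ m) ≤ B := by
  -- `a m := f(s₀2^{-m}) − f(0) − s₀2^{-m}·B` is non-decreasing in `m` and bounded by `s₀2^{-m}·N`
  set a : ℕ → ℝ := fun m => f (s₀ / 2 ^ m) - f 0 - s₀ / 2 ^ m * B with ha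
  have hmono : Monotone a := by
    refine monotone_nat_of_le_succ fun m => ?_
    have hlt : s₀ / 2 ^ (m + 1) < s₀ / 2 ^ m := by
      apply div_lt_div_of_pos_left hs₀ (by positivity)
      rw [pow_succ]
      linarith [pow_pos (by norm_num : (0 : ℝ) < 2) m]
    have h := hdy m
    rw [slope_def_field, div_le_iff₀ (sub_pos.2 hlt)] at h
    simp only [ha]
    linarith
  have hbound : ∀ M : ℕ, a M ≤ s₀ / 2 ^ M * N := by
    intro M
    have h := hlip (s₀ / 2 ^ M) (by positivity)
    have h' : 0 ≤ s₀ / 2 ^ M * B := by positivity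
    simp only [ha]
    linarith
  intro m
  have ham : a m ≤ 0 := by
    refine le_of_forall_pos_lt_add fun ε hε => ?_
    rw [zero_add]
    -- choose `M ≥ m` with `s₀2^{-M}·N < ε`
    obtain ⟨M, hM⟩ : ∃ M : ℕ, s₀ / 2 ^ M * N < ε ∧ m ≤ M := by
      obtain ⟨n, hn⟩ := exists_pow_lt_of_lt_one (div_pos hε (by positivity : (0 : ℝ) < s₀ * (N + 1)))
        (by norm_num : (1 : ℝ) / 2 < 1)
      refine ⟨max n m, ?_, le_max_right _ _⟩
      have hle : (1 / 2 : ℝ) ^ max n m ≤ (1 / 2) ^ n :=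
        pow_le_pow_of_le_one (by norm_num) (by norm_num) (le_max_left _ _)
      have hlt : (1 / 2 : ℝ) ^ max n m < ε / (s₀ * (N + 1)) := hle.trans_lt hn
      rw [lt_div_iff₀ (by positivity)] at hlt
      calc s₀ / 2 ^ max n m * N ≤ s₀ / 2 ^ max n m * (N + 1) := by gcongr; linarith
        _ = (1 / 2) ^ max n m * (s₀ * (N + 1)) := by rw [one_div_pow]; ring
        _ < ε := hlt
    exact (hmono hM.2).trans_lt ((hbound M).trans_lt hM.1)
  have hpos : 0 < s₀ / 2 ^ m := by positivity
  rw [slope_def_field, sub_zero, div_le_iff₀ hpos]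
  simp only [ha] at ham
  linarith

/-! ### The walk for a concave non-decreasing real curve -/

/-- **The secant walk, real form.** Let `f` be concave and non-decreasing on `[0, ∞)` with
`f(t) − f(0) ≤ tN`, let `cond w` ("the near-minimisers at reward `w` are condensed") follow from the
existence of a secant slope `σ(w', w) < M` with `0 ≤ w' < w` (Griffiths), and let every shell `(u, 4u]`,
`4u ≤ S`, whose upper half `(2u, 4u]` satisfies `cond` obey `σ(u,2u) ≤ σ(2u,4u) + A√u`. If
`σ(0, s₀) ≤ M/4` (rung) and `(5/2)A√s₀ ≤ M/4`, `2s₀ ≤ S`, then `σ(0, s) ≤ σ(0, s₀) + (5/2)A√s₀` for all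
`s ∈ (0, s₀]`. Proof: frontier `inf {good} = 0` by the ascending chain and monotonicity, then the
descending chain and telescoping. [cite: Griffiths1966, §III] -/
theorem secant_walk_real {f : ℝ → ℝ} (hf : ConcaveOn ℝ (Ici 0) f) (hmono : MonotoneOn f (Ici 0))
    {s₀ S A M N : ℝ} (hs₀ : 0 < s₀) (hS : 2 * s₀ ≤ S) (hA : 0 ≤ A) (hM : 0 < M) (hN : 0 ≤ N)
    (hlip : ∀ t, 0 ≤ t → f t ≤ f 0 + t * N) (cond : ℝ → Prop)
    (hcond : ∀ w, 0 < w → (∃ w', 0 ≤ w' ∧ w' < w ∧ slope f w' w < M) → cond w)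
    (hshell : ∀ u, 0 < u → 4 * u ≤ S → (∀ w, 2 * u < w → w ≤ 4 * u → cond w) →
      slope f u (2 * u) ≤ slope f (2 * u) (4 * u) + A * Real.sqrt u)
    (hrung : slope f 0 s₀ ≤ M / 4) (hfront : 5 / 2 * A * Real.sqrt s₀ ≤ M / 4) :
    ∀ s, 0 < s → s ≤ s₀ → slope f 0 s ≤ slope f 0 s₀ + 5 / 2 * A * Real.sqrt s₀ := by
  -- GOOD rewards: some secant slope ending at `w` is below the condensation threshold `M`
  set G : Set ℝ := {w | 0 < w ∧ ∃ w', 0 ≤ w' ∧ w' < w ∧ slope f w' w < M} with hG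
  have hG_top : ∀ w, s₀ ≤ w → w ∈ G := fun w hw =>
    ⟨hs₀.trans_le hw, 0, le_rfl, hs₀.trans_le hw,
      (slope_right_anti hf le_rfl hs₀ hw).trans_lt (by linarith)⟩
  have hG_up : ∀ w₁ w₂, w₁ ∈ G → w₁ ≤ w₂ → w₂ ∈ G := by
    rintro w₁ w₂ ⟨hw₁, w', hw'0, hw'1, hsl⟩ h12
    exact ⟨hw₁.trans_le h12, w', hw'0, hw'1.trans_le h12,
      (slope_right_anti hf hw'0 hw'1 h12).trans_lt hsl⟩
  have hGne : G.Nonempty := ⟨s₀, hG_top s₀ le_rfl⟩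
  have hGbdd : BddBelow G := ⟨0, fun w hw => hw.1.le⟩
  have hG_above : ∀ w, sInf G < w → w ∈ G := fun w hw => by
    obtain ⟨g, hg, hgw⟩ := exists_lt_of_csInf_lt hGne hw
    exact hG_up g w hg hgw.le
  -- the frontier `inf G` is at zero
  have hinf : sInf G ≤ 0 := by
    by_contra hpos
    push Not at hpos
    have hts₀ : sInf G ≤ s₀ := csInf_le hGbdd (hG_top s₀ le_rfl)
    -- shells above the frontier are available
    have havail : ∀ u, sInf G / 2 ≤ u → u ≤ s₀ / 2 →
        slope f u (2 * u) ≤ slope f (2 * u) (4 * u) + A * Real.sqrt u := by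
      intro u hu hus
      refine hshell u (by linarith) (by linarith) fun w hw _ => hcond w (by linarith) ?_
      exact (hG_above w (by linarith)).2
    -- locate `s₀` on the dyadic ladder over `inf G / 2`
    obtain ⟨k, hk, hk'⟩ := exists_nat_pow_near
      (show (1 : ℝ) ≤ s₀ / (sInf G / 2) by rw [le_div_iff₀ (by positivity)]; linarith) one_lt_two
    rw [le_div_iff₀ (by positivity)] at hk
    rw [div_lt_iff₀ (by positivity)] at hk'
    have hchain := ascending_chain hf hA hs₀ (by positivity : 0 < sInf G / 2) havail k (sInf G / 2)
      le_rfl hk hk'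
    rw [show 2 * (sInf G / 2) = sInf G by ring] at hchain
    have hX : slope f (sInf G / 2) (sInf G) ≤ M / 2 := by
      have h0 : 0 ≤ 5 / 2 * A * Real.sqrt (sInf G / 2) := by positivity
      linarith
    -- the reward `7·inf G/8` is good (monotonicity of `f` alone): contradiction
    have hw : 7 * sInf G / 8 ∈ G := by
      refine ⟨by positivity, sInf G / 2, by positivity, by linarith, ?_⟩
      have hft : f (7 * sInf G / 8) ≤ f (sInf G) :=
        hmono (mem_Ici.2 (by positivity)) (mem_Ici.2 (by positivity)) (by linarith)
      have hMt : 0 < M * sInf G := mul_pos hM hpos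
      rw [slope_def_field, div_le_iff₀ (by linarith)] at hX
      rw [slope_def_field, div_lt_iff₀ (by linarith)]
      linarith
    have := csInf_le hGbdd hw
    linarith
  -- every positive reward is good, so every shell `4u ≤ S` is available
  have hgood : ∀ w, 0 < w → cond w := fun w hw => hcond w hw (hG_above w (hinf.trans_lt hw)).2
  have havail : ∀ u, 0 < u → u ≤ s₀ / 4 →
      slope f u (2 * u) ≤ slope f (2 * u) (4 * u) + A * Real.sqrt u := fun u hu hus =>
    hshell u hu (by linarith) fun w hw _ => hgood w (by linarith)
  -- descending chain anchored at `s₀`, telescoped down to `0`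
  have hB0 : 0 ≤ slope f 0 s₀ + 5 / 2 * A * Real.sqrt s₀ :=
    add_nonneg (slope_nonneg_of_monotoneOn hmono le_rfl hs₀) (by positivity)
  have hzero := slope_zero_dyadic_le hs₀ hB0 hN hlip (descending_chain hf hA hs₀ havail)
  intro s hs hsle
  obtain ⟨m, hm⟩ := exists_pow_lt_of_lt_one (div_pos hs hs₀) (by norm_num : (1 : ℝ) / 2 < 1)
  have hms : s₀ / 2 ^ m < s := by
    rw [one_div_pow, lt_div_iff₀ hs₀] at hm
    calc s₀ / 2 ^ m = 1 / 2 ^ m * s₀ := by ring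
      _ < s := hm
  exact (slope_right_anti hf le_rfl (by positivity) hms.le).trans (hzero m)

/-- A one-shell inequality `3a ≤ 2b + c + x` in `ℝ≥0∞` with `b, c` finite and `x ≥ 0` real passes to
real parts. [folklore] -/
theorem toReal_three_mul_le {a b c : ℝ≥0∞} {x : ℝ} (hb : b ≠ ⊤) (hc : c ≠ ⊤) (hx : 0 ≤ x)
    (h : 3 * a ≤ 2 * b + c + ENNReal.ofReal x) : 3 * a.toReal ≤ 2 * b.toReal + c.toReal + x := by
  have h2b : 2 * b ≠ ⊤ := ENNReal.mul_ne_top (by simp) hb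
  have hbc : 2 * b + c ≠ ⊤ := ENNReal.add_ne_top.2 ⟨h2b, hc⟩
  have h' := ENNReal.toReal_mono (ENNReal.add_ne_top.2 ⟨hbc, ENNReal.ofReal_ne_top⟩) h
  rw [ENNReal.toReal_add hbc ENNReal.ofReal_ne_top, ENNReal.toReal_add h2b hc,
    ENNReal.toReal_ofReal hx, ENNReal.toReal_mul, ENNReal.toReal_mul] at h'
  simpa using h'

end SecantWalk

end Summit.AtomisticToContinuum.BoseEinsteinCondensation.Cruxes.RewardChordBound.DyadicSecant

end
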